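import Literature.NumberTheory.ComplexMultiplication.ReflexTypeNormDescent                  -- ★ `idealReflexTypeNorm`, `IsReflexTypeNorm`, `reflexNormIdeal_eq_prod`, `isReflexTypeNorm_iff_eq`, `mem_reflexTypeOn_iff`, `exists_ringEquiv_smul_eq`
import Summits.HodgeConjecture.HodgeConjecture.Theorems.F0P6aCanonicalFrobeniusIdealRows   -- ★ p847883 (LA3-p03): the `𝔞_can` token; re-exports ★ p847748 torsor `prod_filter_embeddings_eq`, `ker_residue_restrict_structural_comp_algEquiv`
import HarnessLib

/-!
# Crux `HLiu418` — P6 sub-line **F0-P6a**, organ «FROB-IDÈLE ⇒ `𝔞_can`»: the canonical twist ideal `𝔞_can(m, τR, w)` IS A REFLEX TYPE NORM OF `𝔭_w`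
# (the Galois self-case of Milne՚s Prop. 1.26 (11) read on places, and its junction with the organ-#4 embedding token)

Cell `hodgecm-mathlib` (D-0151), crux `stmt-HodgeConjecture-24832` (hLiu418), `--supports` only (count-neutral).  «L4» LA4-plan (g0) DEAL #22 (2026-09-02T05:26:46Z)
→ LA4-p04 (g2); the (β) link placed INSIDE the X-leaf socket `stub_ESHEET` (05:07:17Z): «reciprocity image of `γ_σ` = Frobenius at `w`», i.e. the IDEAL of the
reflex∕type-norm idèle of the Frobenius idèle is the canonical twist ideal of E-READINGS (FROB-can).  THEOREMS ONLY (no definition, no instance, no notation, no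
named fact, no `sorry`); no `Cruxes/…/Lines` import.

THE CHAIN IT COMPLETES (all other links ★): `il(N_{k,Φ}(prime idèle at 𝔭)) = g_k(𝔭)` is ★ `MainTheoremCMLevelTypeNormBridge.toFractionalIdeal_reflexNormFiniteIdele_localUnits_eq`
(Shimura §18.6 «`𝔮 = g(𝔭)`»; `cmRecipMatrix Φ′ E sE` is `(reflexNormFiniteIdele (K i) (Φ′ i) E sE)ᵢ` by definition); `g_k = g_{k′} ∘ N_{k∕k′}` is ★
`ReflexTypeNormIdealTransitivity.idealReflexTypeNorm_eq_idealReflexTypeNorm_relNorm` (passage from the `cm_recip` field `E` to `F`); THIS FILE: for `F ∕ ℚ` GALOIS (so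
`k = K = F`, all conjugates inside, `Nm_{F∕φF} = id`) the reflex type norm `g_F = idealReflexTypeNorm Φ j σ₀` (★ `ReflexTypeNormDescent`, Shimura՚s `f = g ∘ N_{k∕K*}` on
ideals) of ANY ideal is the GALOIS PRODUCT `∏_{φ ∈ Φ} φ⁻¹𝔞` (§1, Milne (11) with trivial partial norms — proved directly from the descent identity `IsReflexTypeNorm`,
not through `Ideal.relNorm` along a twisted algebra structure), at a place `w` it is `∏ (g • w)` over the inverse half-type (§1), and read through the `p`-adic
torsor `τ = τ_w ∘ g` (★ p847748) it is the EMBEDDING PRODUCT `∏_{τ : σ_w ∘ τ ∈ Φ_Ω} ker (residue ∘ τR τ)` of ★ p847313∕organ #4 (§2) — whence the HEADS (§3):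
**`𝔞_can(m, τR, w) = g_F(𝔭_w)` for the complex type `{φ | ∃ τ, ι ∘ φ = σ_w ∘ τ ∧ m τ ≠ 0 ∧ τ ∤ c•w}`** (organ-#4 token on the left LITERALLY), and the `M ∘ (σ_w ∘ ·)`
form of HEAD-σ (★ p849355).  With the X-leaf՚s twist type `Φ_tw` this is «ideal of `N_{E,Φ_tw}`(Frobenius idèle) `= 𝔞_can`» once the Lines-level filter identity
`{τ | mOf ι₁ Φ (σ_w ∘ τ) ≠ 0 ∧ τ ∤ c•w} = {τ | σ_w ∘ τ ∈ Φ_tw}` (from `KottAdaptedAt`) is supplied E-side.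

MAIN STATEMENTS.  §0 torsor helpers (`exists_algEquiv_comp_eq`, `smul_ideal_eq_map`); §1 **`idealReflexTypeNorm_eq_prod_filter_smul`**
(`g_F(𝔞) = ∏ g ∈ univ.filter (σ₀ ∘ g⁻¹ ∈ Φ), g • 𝔞`), `idealReflexTypeNorm_asIdeal_eq_prod_filter_smul` (places); §2 **`prod_filter_ker_eq_idealReflexTypeNorm`**
(embedding product of the `p`-adic reading of a type `Φ_Ω ⊆ Hom(F, Ω)` = `g_F(𝔭_w)` for `{φ | ι ∘ φ ∈ Φ_Ω}`, any admissible `(Lg, ι, j, σ₀)` with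
`ι ∘ σ₀ = σ_w ∘ (F → F̄_w)`); §3 HEADS **`canonicalTwistIdeal_eq_idealReflexTypeNorm`**, `canonicalTwistIdeal_eq_idealReflexTypeNorm_sigma`.

HC_CM is proved only modulo the 7 printed citations (2 remaining named inputs hLiu418 24832, h413 24833) until rung 0 closes; nothing here changes a count.
[cite: MilneCM2006, Ch. I §1 Prop. 1.26 (11), Rem. 1.25] [cite: Shimura1998, §13.1 (1), (7) and Theorem 1 (pp. 97–99); §18.6 proof pp. 127–128]
[cite: CasselsFrohlichANT1967, Ch. VII §1.1 and Prop. 1.2 (ii)]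
-/

set_option autoImplicit false
set_option linter.dupNamespace false  -- `Summit.HodgeConjecture.HodgeConjecture.…` BY DESIGN (D-0017)

noncomputable section

open NumberField IsDedekindDomain IsLocalRing
open scoped Pointwise
open Literature.NumberTheory.GaloisRepresentations (closureValuationSubring)
open Literature.NumberTheory.Automorphic
open Literature.NumberTheory.ComplexMultiplication
open Summit.HodgeConjecture.HodgeConjecture.Theorems.F0P6aEmbeddingTorsorPlaces (prod_filter_embeddings_eq ker_residue_restrict_structural_comp_algEquiv)

namespace Summit.HodgeConjecture.HodgeConjecture.Theorems.F0P6aCanonicalTwistIdealAsReflexTypeNorm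

variable {F : Type} [Field F] [NumberField F]

/-! ### §0 Torsor helpers: embeddings of the Galois field `F` differ by `Aut(F)`; the Galois action on ideals is extension along the automorphism -/

/-- **Every embedding `φ : F → Lg` is `σ₀ ∘ g` for a unique-up-to-`σ₀` automorphism `g` of the Galois field `F`** (normality: `σ₀(F) = φ(F)`; Mathlib
`AlgHom.restrictNormal'`). [cite: CasselsFrohlichANT1967, Ch. VII §1.1] -/
theorem exists_algEquiv_comp_eq [IsGalois ℚ F] {Lg : Type*} [Field Lg] [CharZero Lg] (σ₀ φ : F →+* Lg) :
    ∃ g : F ≃ₐ[ℚ] F, σ₀.comp (g : F →+* F) = φ := by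
  letI : Algebra F Lg := σ₀.toAlgebra
  refine ⟨AlgHom.restrictNormal' φ.toRatAlgHom F, RingHom.ext fun x => ?_⟩
  have h := AlgHom.restrictNormal_commutes φ.toRatAlgHom F x
  rw [RingHom.comp_apply]
  change algebraMap F Lg ((AlgHom.restrictNormal' φ.toRatAlgHom F) x) = φ x
  rw [AlgHom.restrictNormal', AlgEquiv.coe_ofBijective]
  exact h

/-- `σ₀ ∘ ·` is injective on `Aut(F)` (`σ₀` is injective). [cite: CasselsFrohlichANT1967, Ch. VII §1.1] -/
theorem comp_algEquiv_injective {Lg : Type*} [Field Lg] (σ₀ : F →+* Lg) :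
    Function.Injective fun g : F ≃ₐ[ℚ] F => σ₀.comp (g : F →+* F) := fun g g' h =>
  AlgEquiv.ext fun x => σ₀.injective (by simpa using RingHom.congr_fun h x)

/-- **The Galois action on the ideals of `𝓞 F` is extension along the automorphism**: `g • 𝔞 = 𝔞.map (mapRingHom g)` (Mathlib pointwise action; both restrict
`g` to `𝓞 F`). [cite: CasselsFrohlichANT1967, Ch. VII §1.1] -/
theorem smul_ideal_eq_map (g : F ≃ₐ[ℚ] F) (𝔞 : Ideal (𝓞 F)) :
    g • 𝔞 = 𝔞.map (RingOfIntegers.mapRingHom (g : F →+* F)) := by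
  rw [Ideal.pointwise_smul_def]
  congr 1

omit [NumberField F] in
/-- Extension along `j ∘ g` is extension along `g` then along `j`. [folklore] [cite: CasselsFrohlichANT1967, Ch. VII §1.1] -/
theorem map_mapRingHom_comp {Lg : Type*} [Field Lg] (j : F →+* Lg) (g : F →+* F) (𝔞 : Ideal (𝓞 F)) :
    𝔞.map (RingOfIntegers.mapRingHom (j.comp g)) =
      (𝔞.map (RingOfIntegers.mapRingHom g)).map (RingOfIntegers.mapRingHom j) := by
  rw [Ideal.map_map]
  congr 1

/-! ### §1 Milne (11) in the Galois self-case: `g_F(𝔞) = ∏_{φ ∈ Φ} φ⁻¹ 𝔞`, indexed by the automorphisms `g` with `σ₀ ∘ g⁻¹ ∈ Φ` -/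

section SelfCase

variable [IsGalois ℚ F] {Lg : Type*} [Field Lg] [NumberField Lg] [IsGalois ℚ Lg]

/-- **THE REFLEX TYPE NORM OF AN IDEAL OF THE GALOIS CM FIELD IS ITS GALOIS PRODUCT**: for `F ∕ ℚ` Galois, ANY `Φ ⊆ Hom(F, Lg)` (`Lg ∕ ℚ` Galois), base
embeddings `j` (of the field acted on) and `σ₀` (of the field of definition, both `F`), and every ideal `𝔞 ⊆ 𝓞_F`:
`idealReflexTypeNorm Φ j σ₀ 𝔞 = ∏ g ∈ univ.filter (σ₀ ∘ g⁻¹ ∈ Φ), g • 𝔞` — Milne՚s `N_{k,Φ}(𝔞) = ∏_{φ ∈ Φ} φ⁻¹(Nm_{k∕φK} 𝔞)` with `k = K = F`, `Nm = id`,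
`φ = σ₀ ∘ g⁻¹ ↦ "φ⁻¹" = g`.  PROOF from the descent identity: the reflex type ON `F` is `Ψ_j(F) = {j ∘ g | σ₀ ∘ g⁻¹ ∈ Φ}` (transitivity of `Aut(Lg)` on embeddings,
★ `exists_ringEquiv_smul_eq`, and the torsor §0), and `𝔞^{j ∘ g}𝓞_{Lg} = j(g • 𝔞)𝓞_{Lg}`; uniqueness of the descent (★ `isReflexTypeNorm_iff_eq`).
[cite: MilneCM2006, Ch. I §1 Prop. 1.26 (11)] [cite: Shimura1998, §13.1 (1), (7)] -/
theorem idealReflexTypeNorm_eq_prod_filter_smul (Φ : Set (F →+* Lg)) [DecidablePred (· ∈ Φ)] (j σ₀ : F →+* Lg) (𝔞 : Ideal (𝓞 F)) :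
    idealReflexTypeNorm Φ j σ₀ 𝔞 =
      ∏ g ∈ Finset.univ.filter (fun g : F ≃ₐ[ℚ] F => σ₀.comp ((g⁻¹ : F ≃ₐ[ℚ] F) : F →+* F) ∈ Φ), g • 𝔞 := by
  symm
  rw [← isReflexTypeNorm_iff_eq]
  -- the descent identity `j(∏ g • 𝔞)𝓞_{Lg} = ∏_{σ ∈ Ψ_j(F)} 𝔞^σ 𝓞_{Lg}`
  change Ideal.map (RingOfIntegers.mapRingHom j) _ = reflexNormIdeal Φ j σ₀ 𝔞
  rw [reflexNormIdeal_eq_prod, ← Ideal.mapHom_apply, map_prod]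
  -- reindex `Ψ_j(F)` by `g ↦ j ∘ g`
  refine Finset.prod_nbij (fun g : F ≃ₐ[ℚ] F => j.comp (g : F →+* F)) (fun g hg => ?_) (fun g _ g' _ h => ?_)
    (fun σ hσ => ?_) (fun g _ => ?_)
  · -- `σ₀ ∘ g⁻¹ ∈ Φ ⇒ j ∘ g ∈ Ψ_j(F)`: the automorphism `G` of `Lg` with `G ∘ σ₀ = j ∘ g` has `G⁻¹ ∘ j = σ₀ ∘ g⁻¹`
    rw [Finset.mem_filter] at hg
    rw [Set.Finite.mem_toFinset, mem_reflexTypeOn_iff]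
    obtain ⟨G, hG⟩ := exists_ringEquiv_smul_eq σ₀ (j.comp (g : F →+* F))
    refine ⟨G, ?_, hG⟩
    have hGinv : G⁻¹ • j = σ₀.comp ((g⁻¹ : F ≃ₐ[ℚ] F) : F →+* F) := by
      rw [inv_smul_eq_iff]
      refine RingHom.ext fun x => ?_
      have hx := RingHom.congr_fun hG ((g⁻¹ : F ≃ₐ[ℚ] F) x)
      rw [ringEquiv_smul_apply, RingHom.comp_apply] at hx
      -- `hx : G (σ₀ (g⁻¹ x)) = j (g (g⁻¹ x))`
      change G (σ₀ (g.symm x)) = j (g (g.symm x)) at hx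
      rw [AlgEquiv.apply_symm_apply] at hx
      change j x = G (σ₀ (g.symm x))
      rw [hx]
    rw [hGinv]
    exact hg.2
  · exact comp_algEquiv_injective j h
  · -- surjectivity onto `Ψ_j(F)`: `σ = G ∘ σ₀` with `G⁻¹ ∘ j = σ₀ ∘ g' ∈ Φ`; then `σ = j ∘ g'⁻¹`
    rw [Set.Finite.coe_toFinset, mem_reflexTypeOn_iff] at hσ
    obtain ⟨G, hGΦ, rfl⟩ := hσ
    obtain ⟨g', hg'⟩ := exists_algEquiv_comp_eq σ₀ (G⁻¹ • j)
    refine ⟨g'⁻¹, ?_, ?_⟩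
    · rw [Finset.mem_coe, Finset.mem_filter, inv_inv, hg']
      exact ⟨Finset.mem_univ _, hGΦ⟩
    · refine RingHom.ext fun x => ?_
      have hx := RingHom.congr_fun hg' ((g'⁻¹ : F ≃ₐ[ℚ] F) x)
      rw [RingHom.comp_apply, ringEquiv_smul_apply] at hx
      -- `hx : σ₀ (g' (g'⁻¹ x)) = G⁻¹ (j (g'⁻¹ x))`
      change σ₀ (g' (g'.symm x)) = G.symm (j (g'.symm x)) at hx
      rw [AlgEquiv.apply_symm_apply] at hx
      change j (g'.symm x) = G (σ₀ x)
      rw [hx, RingEquiv.apply_symm_apply]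
  · rw [Ideal.mapHom_apply, smul_ideal_eq_map, ← map_mapRingHom_comp]

/-- **At a place**: `g_F(𝔭_w) = ∏ g ∈ univ.filter (σ₀ ∘ g⁻¹ ∈ Φ), 𝔭_{g • w}` (★ `GaloisActionPlaces`: `(g • w).asIdeal = g • 𝔭_w`) — the reflex type norm
of the prime `𝔭_w` of the Galois CM field is the product of its conjugates over the INVERSE half-type `{g | σ₀ ∘ g⁻¹ ∈ Φ}` (Shimura §13.1 (7):
«`∏_{τ ∈ S*} 𝔓₁^τ ∼ ∏_α N_{k₁∕K*}(𝔓₁)^{ψ_α}`»). [cite: Shimura1998, §13.1 (7) and Theorem 1 (pp. 97–99)] [cite: MilneCM2006, Ch. I §1 Prop. 1.26 (11)] -/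
theorem idealReflexTypeNorm_asIdeal_eq_prod_filter_smul (Φ : Set (F →+* Lg)) [DecidablePred (· ∈ Φ)] (j σ₀ : F →+* Lg)
    (w : HeightOneSpectrum (𝓞 F)) :
    idealReflexTypeNorm Φ j σ₀ w.asIdeal =
      ∏ g ∈ Finset.univ.filter (fun g : F ≃ₐ[ℚ] F => σ₀.comp ((g⁻¹ : F ≃ₐ[ℚ] F) : F →+* F) ∈ Φ), ((g • w).asIdeal : Ideal (𝓞 F)) := by
  rw [idealReflexTypeNorm_eq_prod_filter_smul]
  exact Finset.prod_congr rfl fun g _ => (HeightOneSpectrum.smul_asIdeal g w).symm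

end SelfCase

/-! ### §2 JUNCTION with the organ-#4 embedding currency: the embedding product of the `p`-adic reading of a type is its reflex type norm of `𝔭_w` -/

section Junction

variable [IsGalois ℚ F] (w : HeightOneSpectrum (𝓞 F))
  (τR : (F →+* AlgebraicClosure (w.adicCompletion F)) → (𝓞 F →+* ↥(closureValuationSubring (w.adicCompletion F))))
  (hτR : ∀ (τ : F →+* AlgebraicClosure (w.adicCompletion F)) (x : 𝓞 F),
    ((τR τ x : ↥(closureValuationSubring (w.adicCompletion F))) : AlgebraicClosure (w.adicCompletion F)) = τ (x : F))
  {Lg : Type*} [Field Lg] [NumberField Lg] [IsGalois ℚ Lg] {Ω : Type*} [Field Ω]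

include hτR in
/-- **THE EMBEDDING PRODUCT IS A REFLEX TYPE NORM OF `𝔭_w`**: for any field `Ω` (consumer: `ℂ`), any `Φ_Ω ⊆ Hom(F, Ω)`, any embedding `σ_w : F̄_w → Ω` and any
admissible presentation `(Lg, ι, j, σ₀)` (`Lg ∕ ℚ` Galois, `ι : Lg → Ω`, `j σ₀ : F → Lg`) COMPATIBLE with `σ_w` on `F` (`ι ∘ σ₀ = σ_w|_F`, both `= ι₁` in use):
`∏_{τ : F → F̄_w, σ_w ∘ τ ∈ Φ_Ω} ker (residue ∘ τR τ) = g_F(𝔭_w)` for the type `{φ : F → Lg | ι ∘ φ ∈ Φ_Ω}` — §1 at `𝔭_w`, read through the torsor `τ = τ_w ∘ g`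
(★ p847748 `prod_filter_embeddings_eq`, «`τ_w ∘ g` induces `g⁻¹ • w`» `ker_residue_restrict_structural_comp_algEquiv`) and `g ↦ g⁻¹`.  This is the (FROB-can)
discharge in IDEAL currency: with ★ `toFractionalIdeal_reflexNormFiniteIdele_localUnits_eq` (prime idèle ↦ `g(𝔭)`) and ★ transitivity `g_E = g_F ∘ (N_{F∕E})⁻¹`-wise
(`idealReflexTypeNorm_eq_idealReflexTypeNorm_relNorm`), the ideal of the reflex-norm idèle of the Frobenius idèle IS this embedding product.
[cite: Shimura1998, §13.1 (7) and Theorem 1 (pp. 97–99); §18.6 proof pp. 127–128] [cite: MilneCM2006, Ch. I §1 Prop. 1.26 (11)] [cite: CasselsFrohlichANT1967, Ch. VII §1.1] -/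
theorem prod_filter_ker_eq_idealReflexTypeNorm (ΦΩ : Set (F →+* Ω)) [DecidablePred (· ∈ ΦΩ)]
    (σw : AlgebraicClosure (w.adicCompletion F) →+* Ω) (ι : Lg →+* Ω) (j σ₀ : F →+* Lg)
    (hcompat : ι.comp σ₀ = σw.comp (algebraMap F (AlgebraicClosure (w.adicCompletion F)))) :
    ∏ τ ∈ Finset.univ.filter (fun τ : F →+* AlgebraicClosure (w.adicCompletion F) => σw.comp τ ∈ ΦΩ),
        RingHom.ker ((residue ↥(closureValuationSubring (w.adicCompletion F))).comp (τR τ)) =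
      idealReflexTypeNorm {φ : F →+* Lg | ι.comp φ ∈ ΦΩ} j σ₀ w.asIdeal := by
  classical
  -- the compatibility in the `K̂_w`-tower form of the torsor lemmas
  have hc : σw.comp ((algebraMap (w.adicCompletion F) (AlgebraicClosure (w.adicCompletion F))).comp
      (algebraMap F (w.adicCompletion F))) = ι.comp σ₀ := by
    rw [← IsScalarTower.algebraMap_eq]; exact hcompat.symm
  rw [idealReflexTypeNorm_asIdeal_eq_prod_filter_smul, prod_filter_embeddings_eq w]
  refine Finset.prod_equiv (Equiv.inv (F ≃ₐ[ℚ] F)) (fun g => ?_) (fun g _ => ?_)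
  · simp only [Finset.mem_filter, Finset.mem_univ, true_and, Equiv.inv_apply, inv_inv, Set.mem_setOf_eq]
    rw [← RingHom.comp_assoc, hc, RingHom.comp_assoc]
  · rw [Equiv.inv_apply, ker_residue_restrict_structural_comp_algEquiv w τR hτR g]

/-! ### §3 HEADS: the canonical twist ideal `𝔞_can(m, τR, w)` (organ #4 ∕ ★ p847883 TOKEN, literally) is a reflex type norm of `𝔭_w` -/

variable [IsCMField F]

include hτR in
/-- **HEAD «FROB-IDÈLE ⇒ `𝔞_can`» (m-form) — `𝔞_can(m, τR, w) = g_F(𝔭_w)`** for the type `{φ : F → Lg | ∃ τ, ι ∘ φ = σ_w ∘ τ ∧ m τ ≠ 0 ∧ τ ∤ c•w}` (the organ-#4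
index set read in `Lg` through `σ_w` and `ι`): LEFT side = the canonical twist ideal token of ★ p847883 ∕ organ #4 ∕ E-READINGS (FROB-can) ∕ ★ p849355 HEAD-m,
VERBATIM; RIGHT side = ★ `idealReflexTypeNorm` (Shimura՚s `g` on ideals), i.e. — through ★ `toFractionalIdeal_reflexNormFiniteIdele_localUnits_eq` — the ideal of
the reflex-norm idèle (`cmRecipMatrix` entry) of the Frobenius idèle at `w`.  (§2 with `Φ_Ω := σ_w ∘ {τ | m τ ≠ 0 ∧ τ ∤ c•w}`, `σ_w ∘ ·` injective.)
[cite: Shimura1998, §13.1 Theorem 1 (pp. 97–99) and (7); §18.6 proof pp. 127–128] [cite: MilneCM2006, Ch. I §1 Prop. 1.26 (11)] -/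
theorem canonicalTwistIdeal_eq_idealReflexTypeNorm (m : (F →+* AlgebraicClosure (w.adicCompletion F)) → ℕ)
    (σw : AlgebraicClosure (w.adicCompletion F) →+* Ω) (ι : Lg →+* Ω) (j σ₀ : F →+* Lg)
    (hcompat : ι.comp σ₀ = σw.comp (algebraMap F (AlgebraicClosure (w.adicCompletion F)))) :
    (∏ τ ∈ Finset.univ.filter (fun τ : F →+* AlgebraicClosure (w.adicCompletion F) =>
        m τ ≠ 0 ∧ RingHom.ker ((residue ↥(closureValuationSubring (w.adicCompletion F))).comp (τR τ)) ≠
          (((IsCMField.complexConj F) • w).asIdeal : Ideal (𝓞 F))),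
      RingHom.ker ((residue ↥(closureValuationSubring (w.adicCompletion F))).comp (τR τ))) =
    idealReflexTypeNorm {φ : F →+* Lg | ∃ τ : F →+* AlgebraicClosure (w.adicCompletion F), ι.comp φ = σw.comp τ ∧
        m τ ≠ 0 ∧ RingHom.ker ((residue ↥(closureValuationSubring (w.adicCompletion F))).comp (τR τ)) ≠
          (((IsCMField.complexConj F) • w).asIdeal : Ideal (𝓞 F))} j σ₀ w.asIdeal := by
  classical
  have key := prod_filter_ker_eq_idealReflexTypeNorm w τR hτR
    {ψ : F →+* Ω | ∃ τ : F →+* AlgebraicClosure (w.adicCompletion F), ψ = σw.comp τ ∧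
      m τ ≠ 0 ∧ RingHom.ker ((residue ↥(closureValuationSubring (w.adicCompletion F))).comp (τR τ)) ≠
        (((IsCMField.complexConj F) • w).asIdeal : Ideal (𝓞 F))} σw ι j σ₀ hcompat
  refine Eq.trans (Finset.prod_congr (Finset.filter_congr fun τ _ => ?_) fun _ _ => rfl) key
  -- `σ_w ∘ ·` is injective, so the index conditions agree
  simp only [Set.mem_setOf_eq]
  constructor
  · rintro h
    exact ⟨τ, rfl, h⟩
  · rintro ⟨τ', hτ', h⟩
    have : τ = τ' := RingHom.ext fun x => σw.injective (RingHom.congr_fun hτ' x)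
    subst this
    exact h

include hτR in
/-- **HEAD «FROB-IDÈLE ⇒ `𝔞_can`» (σ-form, the ★ p849355 HEAD-σ ∕ E-READINGS (FROB-can) spelling `m := M ∘ (σ_w ∘ ·)`)**: for a signature function `M` on the
`Ω`-valued embeddings (consumer: `Ω := ℂ`, `M := mOf ι₁ (Φf i)`, `σ_w` over `ι₁`),
`𝔞_can(M ∘ (σ_w ∘ ·), τR, w) = g_F(𝔭_w)` for the type `{φ : F → Lg | M (ι ∘ φ) ≠ 0 ∧ ∃ τ, ι ∘ φ = σ_w ∘ τ ∧ τ ∤ c•w}`.  Under `KottAdaptedAt` the X-leaf replaces this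
`w`-dependent set by its twist type `{φ | M φ ≠ 0 ∧ φ ≠ ῑ₁}` read in `Lg` (Lines-level filter identity) and reads §2 directly.
[cite: Shimura1998, §13.1 Theorem 1 (pp. 97–99) and (7)] [cite: MilneCM2006, Ch. I §1 Prop. 1.26 (11)] [cite: RapoportSmithlingZhang2020Diagonal, §4.1 (4.6) p. 16 and p. 17] -/
theorem canonicalTwistIdeal_eq_idealReflexTypeNorm_sigma (M : (F →+* Ω) → ℕ)
    (σw : AlgebraicClosure (w.adicCompletion F) →+* Ω) (ι : Lg →+* Ω) (j σ₀ : F →+* Lg)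
    (hcompat : ι.comp σ₀ = σw.comp (algebraMap F (AlgebraicClosure (w.adicCompletion F)))) :
    (∏ τ ∈ Finset.univ.filter (fun τ : F →+* AlgebraicClosure (w.adicCompletion F) =>
        M (σw.comp τ) ≠ 0 ∧ RingHom.ker ((residue ↥(closureValuationSubring (w.adicCompletion F))).comp (τR τ)) ≠
          (((IsCMField.complexConj F) • w).asIdeal : Ideal (𝓞 F))),
      RingHom.ker ((residue ↥(closureValuationSubring (w.adicCompletion F))).comp (τR τ))) =
    idealReflexTypeNorm {φ : F →+* Lg | M (ι.comp φ) ≠ 0 ∧ ∃ τ : F →+* AlgebraicClosure (w.adicCompletion F),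
        ι.comp φ = σw.comp τ ∧ RingHom.ker ((residue ↥(closureValuationSubring (w.adicCompletion F))).comp (τR τ)) ≠
          (((IsCMField.complexConj F) • w).asIdeal : Ideal (𝓞 F))} j σ₀ w.asIdeal := by
  classical
  have key := prod_filter_ker_eq_idealReflexTypeNorm w τR hτR
    {ψ : F →+* Ω | M ψ ≠ 0 ∧ ∃ τ : F →+* AlgebraicClosure (w.adicCompletion F), ψ = σw.comp τ ∧
      RingHom.ker ((residue ↥(closureValuationSubring (w.adicCompletion F))).comp (τR τ)) ≠
        (((IsCMField.complexConj F) • w).asIdeal : Ideal (𝓞 F))} σw ι j σ₀ hcompat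
  refine Eq.trans (Finset.prod_congr (Finset.filter_congr fun τ _ => ?_) fun _ _ => rfl) key
  simp only [Set.mem_setOf_eq]
  constructor
  · rintro ⟨hM, h⟩
    exact ⟨hM, τ, rfl, h⟩
  · rintro ⟨hM, τ', hτ', h⟩
    have : τ = τ' := RingHom.ext fun x => σw.injective (RingHom.congr_fun hτ' x)
    subst this
    exact ⟨hM, h⟩

end Junction

end Summit.HodgeConjecture.HodgeConjecture.Theorems.F0P6aCanonicalTwistIdealAsReflexTypeNorm

end
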